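/-
Copyright (c) 2026 the pub-hodgecm-mathlib formalisation cell (harness21).  Prover seat hodgecm-mathlib-LH4-p07 (g6), req620 Track A «(D-RAM) FOUR-FRAME» squad
(unit U2H_HSide, the (ρ2b′-X) road :418; payer by lineage LH4-p14 (g4) 2026-09-04T04:44Z «(γ) O-Glue COUNT organ, take it by name»; dealer LH4-plan (g12) WORD #21∕#22).
-/
import Summits.HodgeConjecture.HodgeConjecture.Theorems.F0P3cDyRamBlockGluePlane  -- file 1∕2 (this seat): plane glue data, fixed criterion in plane letters, (L5)(L6); brings ★ T2c∕T2a, ★ TubeCoordinate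
import Literature.NumberTheory.Automorphic.UnitaryLatticeTreeBlockGlueFibration     -- ★ p857312 (this seat): `#F = #axis + Σ_b Σᶠ_B #cell(B, b)`, `ncard_eq_finsum_ncard_fiber`
import Literature.NumberTheory.Automorphic.UnitaryLatticeTreeAxisCountTransport     -- ★ (z1-d) p847750: the axis part of a fixed count is a `W`-side count
import HarnessLib

/-!
# Crux `H413`, line LH4 «(D-RAM) FOUR-FRAME» — the (ρ2b′-X) road, organ O-Glue: THE FIXED SELF-DUAL LATTICES OF A BLOCK ELEMENT, COUNTED THROUGH THE PLANE
# `#{M self-dual ∣ Γ·M = M} = #{B₂ self-dual for H₂ ∣ γ₂B₂ = B₂} + Σ_{b=1}^{R} Σᶠ_{B₂ ∈ S_b(γ₂, u)} #fibre(ι_W B₂, b)` (file 2∕2: the count)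

Cell `hodgecm-mathlib` (D-0151), FLOOR 0, crux item H413 = `stmt-HodgeConjecture-24833`, route of record `HCCMUnconditional`; squad F0∕P3c∕LH4; registered stub concerned:
`F0P3cDyRamFourFrameU2H.stub_U2H_fixedPointCensus_typeTwo_unit0` ((ρ2b′-X), U2H ED. 15 :418) through the payer lineage's HEAD-OF-ORGANS over ★ p857374 `…SignedCensusNV`.
THEOREMS ONLY (no `def`, no instance, no notation, no `sorry`); lane `--supports stmt-HodgeConjecture-24833 --as helper` (count-neutral).  DATUM-FREE (`K` valued, `𝒪[K]` a PID,
`σ` an isometric involution, `|ϖ| = exp(−1)`, block form with `H₂` hermitian of unit determinant, `|h| = 1`, `σh = h`; no `|2|`, no residue field).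

THE MATHEMATICS.  Block currency of ★ `UnitaryLatticeTreeTubeCoordinate`: `V = K³ = W ⊕ Ke₁`, `W = ker pr₁ = ι_W(K²)` (`ι_W y = (y₀, 0, y₁)`, ★ T2c `planeMatrix`),
`H = !![H₂ 0 0, 0, H₂ 0 1; 0, h, 0; H₂ 1 0, 0, H₂ 1 1]`, `Γ = endoGL (γ₂, u)` a block element, UNITARY for `H` (so `|u| = 1`, `|det γ₂| = 1`).  Let `F = {M self-dual ∣ Γ·M = M}`,
finite with tube coordinates `≤ R` (hypotheses; ★ `…BlockFixedFinite` ∕ `tubeCoordinate_le_of_v_det_eq` discharge them at the HEAD).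
§1 AXIS (`b = 0`): `#{M ∈ F ∣ e₁ ∈ M} = #{B₂ ∣ B₂ self-dual for H₂ ∧ γ₂B₂ = B₂}` — ★ (z1-d) `ncard_selfDual_fixed_axis_eq` at trivial labels.
§2 PLANE GLUE DATA (T2-side, `b ≥ 1`): every self-dual `M` with tube coordinate `b ≥ 1` carries `(B₂, w₀, x₀)`: `B₂ = g·𝒪²` a plane lattice with `ι_W(B₂) = M ∩ W`, a generator
`x₀ ∈ M` (`|x₀,₁|·|ϖ|^b = 1`) with `pr_W x₀ = ι_W w₀`, and the three ★ T2b binders in `H₂`-currency — (G1) `B₂ = (B₂ + 𝒪w₀)^♯`, (gen) `B₂^♯ = B₂ + 𝒪w₀`, (norm)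
`|⟨w₀, w₀⟩|·|ϖ|^{2b} = 1` (★ T2a `glueData_of_generator` + ★ T2c `glueCondition_map_planeMatrix_iff_dualLatt_sup_span_eq` + ★ `v_pairing_generator_proj` + PID sandwich + double dual).
§3 FIXED CRITERION IN PLANE LETTERS: for such data, `Γ·M = M ⟺ γ₂B₂ = B₂ ∧ γ₂w₀ − u·w₀ ∈ B₂` (★ T2c `mapGL_endoGL_eq_iff_of_generator` read through ★ T2c §3; `⊆ ⇒ =` by
`|det γ₂| = 1`, ★ `mapGL_latt_eq_latt_iff`), and the depth clause does not depend on the representative `w₀` (§4).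
§5 LAYER COUNT (`b ≥ 1`): `Σᶠ_B #cell(B, b) = Σᶠ_{B₂ ∈ S_b} #fibre(ι_W B₂, b)` where `cell(B, b) = {M ∈ F ∣ tube b, M ∩ W = B}` (★ p857312's cells), `fibre(B, b) = {M self-dual ∣
M ∩ W = B, tube b}` (★ T2b's LHS, `w₀`-free) and `S_b` is LH4-p12 (g4)'s ★ p857377 `ncard_coneWParts_eq_sum` INDEX SET VERBATIM: `(∃ g, B₂ = latt g) ∧ mapGL γ₂ B₂ = B₂ ∧ ∃ w₀, (G1) ∧
(gen) ∧ (norm) ∧ γ₂w₀ − u·w₀ ∈ B₂` — a cell is either empty or a whole fibre (§3: the gluing digit never enters the fixed criterion), and the non-empty cells are exactly those over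
`ι_W B₂`, `B₂ ∈ S_b`.  §6 HEAD := ★ p857312 §2 ⊕ §1 ⊕ §5.  Each fibre is then a norm-residue count `#Sol_{2b}(r_{B₂})` by ★ T2b `ncard_glueFibre_eq_natCard_normFibre` at ANY
admissible `w₀` (the O-Cone hand's canonical one, ★ p857341∕p857361∕p857377) — left un-evaluated here (payer's ask (ii)).
HONEST LABEL.  Count-neutral lattice bookkeeping; nothing printed is asserted; (ρ2b′-X) stays OPEN; `HC_CM` is proved only modulo the 7 printed citations (2 remaining named inputs:
hLiu418 = `stmt-HodgeConjecture-24832`, h413 = `stmt-HodgeConjecture-24833`) until rung 0 closes.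

## References
* [BruhatTits1972] F. Bruhat, J. Tits, *Groupes réductifs sur un corps local I*, Publ. Math. IHÉS 41 (1972), §10 (lattice models of the rank-one building; tube layers).
* [Kottwitz1986BaseChangeUnits] R. E. Kottwitz, *Base change for unit elements of Hecke algebras*, Compositio Math. 60 (1986), §1 pp. 240–241 (orbital integrals of units as
  fixed-lattice counts), §3 pp. 247–249 (reduction to Levi blocks).
* [Jacobowitz1962] R. Jacobowitz, *Hermitian forms over local fields*, Amer. J. Math. 84 (1962), §4 (dual lattices, gluing of modular components).
* [Rogawski1990] J. D. Rogawski, *Automorphic Representations of Unitary Groups in Three Variables*, Ann. of Math. Stud. 123 (1990), §4.8 Case (a) p. 53, §4.9 p. 55.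
-/

set_option autoImplicit false

noncomputable section

namespace Summit.HodgeConjecture.HodgeConjecture.Cruxes.H413.F0P3cDyRamBlockGlueCount

open scoped Valued WithZero Matrix MatrixGroups
open Literature.NumberTheory.Automorphic Literature.NumberTheory.Automorphic.HermitianLattice Literature.NumberTheory.Automorphic.UnitaryLatticeTree
open Literature.NumberTheory.Rogawski1990
open Summit.HodgeConjecture.HodgeConjecture.Cruxes.H413.F0P3cDyRamBlockGluePlane

variable {K : Type*} [Field K] [Valued K ℤᵐ⁰]

/-! ## §1 The axis term (`b = 0`) is the count of `γ₂`-fixed self-dual plane lattices -/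

/-- **AXIS TERM.**  `#{M self-dual ∣ Γ·M = M, e₁ ∈ M} = #{B₂ self-dual for H₂ ∣ γ₂·B₂ = B₂}` for the block element `Γ = endoGL (γ₂, u)`, `|u| = 1` — ★ (z1-d)
`ncard_selfDual_fixed_axis_eq` at the trivial labels, in ★ p857312's axis letters. [cite: BruhatTits1972, §10] [cite: Kottwitz1986BaseChangeUnits, §3 pp. 247–249] -/
theorem ncard_fixed_axis_eq_ncard_plane (σ : K →+* K) (hvσ : ∀ a, Valued.v (σ a) = Valued.v a) {ϖ : K} (hϖ : Valued.v ϖ = WithZero.exp (-1 : ℤ))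
    {H₂ : Matrix (Fin 2) (Fin 2) K} (hH₂ : IsUnit H₂.det) {h : K} (hh : Valued.v h = 1)
    (γ₂ : GL (Fin 2) K) {u : GL (Fin 1) K} (hu : Valued.v ((u : Matrix (Fin 1) (Fin 1) K) 0 0) = 1) :
    {M : Submodule 𝒪[K] (Fin 3 → K) |
        (IsSelfDualLattice σ ϖ (!![H₂ 0 0, 0, H₂ 0 1; 0, h, 0; H₂ 1 0, 0, H₂ 1 1] : Matrix (Fin 3) (Fin 3) K) M ∧ mapGL (endoGL (γ₂, u)) M = M) ∧
          (Pi.single 1 1 : Fin 3 → K) ∈ M}.ncard =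
      {B₂ : Submodule 𝒪[K] (Fin 2 → K) | IsSelfDualLattice σ ϖ H₂ B₂ ∧ mapGL γ₂ B₂ = B₂}.ncard := by
  have hϖ0 : ϖ ≠ 0 := fun h0 => by rw [h0, map_zero] at hϖ; exact WithZero.coe_ne_zero hϖ.symm
  have hϖ1 : Valued.v ϖ ≤ 1 := by rw [hϖ, ← WithZero.exp_zero, WithZero.exp_le_exp]; norm_num
  have key := ncard_selfDual_fixed_axis_eq σ hvσ hϖ0 hϖ1 hH₂ hh γ₂ hu (fun _ => True) (fun _ => True) (fun _ => Iff.rfl)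
  have e₁ : {M : Submodule 𝒪[K] (Fin 3 → K) |
        (IsSelfDualLattice σ ϖ (!![H₂ 0 0, 0, H₂ 0 1; 0, h, 0; H₂ 1 0, 0, H₂ 1 1] : Matrix (Fin 3) (Fin 3) K) M ∧ mapGL (endoGL (γ₂, u)) M = M) ∧
          (Pi.single 1 1 : Fin 3 → K) ∈ M} =
      {M : Submodule 𝒪[K] (Fin 3 → K) |
        IsSelfDualLattice σ ϖ (!![H₂ 0 0, 0, H₂ 0 1; 0, h, 0; H₂ 1 0, 0, H₂ 1 1] : Matrix (Fin 3) (Fin 3) K) M ∧ mapGL (endoGL (γ₂, u)) M = M ∧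
          (Pi.single 1 1 : Fin 3 → K) ∈ M ∧ True} := by
    ext M; simp only [Set.mem_setOf_eq, and_true, and_assoc]
  have e₂ : {B₂ : Submodule 𝒪[K] (Fin 2 → K) | IsSelfDualLattice σ ϖ H₂ B₂ ∧ mapGL γ₂ B₂ = B₂} =
      {B₂ : Submodule 𝒪[K] (Fin 2 → K) | IsSelfDualLattice σ ϖ H₂ B₂ ∧ mapGL γ₂ B₂ = B₂ ∧ True} := by
    ext B; simp only [Set.mem_setOf_eq, and_true]
  rw [e₁, e₂]
  exact key

/-! ## §5 The tube layer `b ≥ 1`: cells are empty or whole fibres, indexed by LH4-p12 (g4)'s cone index set -/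

/-- **LAYER COUNT.**  For a UNITARY block element `Γ = endoGL (γ₂, u)` whose fixed self-dual family is finite, and `b ≥ 1`:
`Σᶠ_B #{M self-dual ∣ Γ·M = M, tube b, M ∩ W = B} = Σᶠ_{B₂ ∈ S_b} #{M self-dual ∣ M ∩ W = ι_W B₂, tube b}`, `S_b` = ★ p857377 `ncard_coneWParts_eq_sum`'s index set VERBATIM
(`(∃ g, B₂ = latt g) ∧ mapGL γ₂ B₂ = B₂ ∧ ∃ w₀, (G1) ∧ (gen) ∧ (norm) ∧ γ₂w₀ − u·w₀ ∈ B₂`) and the summand = ★ T2b `ncard_glueFibre_eq_natCard_normFibre`'s LHS (`w₀`-free).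
[cite: BruhatTits1972, §10] [cite: Kottwitz1986BaseChangeUnits, §1 pp. 240–241] [cite: Jacobowitz1962, §4] -/
theorem finsum_ncard_glueCell_eq_finsum_mem_ncard_glueFibre [IsPrincipalIdealRing 𝒪[K]] (σ : K →+* K) (hσ : ∀ a, σ (σ a) = a)
    (hvσ : ∀ a, Valued.v (σ a) = Valued.v a) {ϖ : K} (hϖ : Valued.v ϖ = WithZero.exp (-1 : ℤ))
    {H₂ : Matrix (Fin 2) (Fin 2) K} (hH₂ : IsUnit H₂.det) (hH₂σ : (H₂.map σ)ᵀ = H₂) {h : K} (hh : Valued.v h = 1)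
    (γ₂ : GL (Fin 2) K) (u : GL (Fin 1) K) (hΓ : endoGL (γ₂, u) ∈ unitaryGroupOfForm σ (!![H₂ 0 0, 0, H₂ 0 1; 0, h, 0; H₂ 1 0, 0, H₂ 1 1] : Matrix (Fin 3) (Fin 3) K))
    (hu : Valued.v ((u : Matrix (Fin 1) (Fin 1) K) 0 0) = 1)
    (hfin : {M : Submodule 𝒪[K] (Fin 3 → K) |
      IsSelfDualLattice σ ϖ (!![H₂ 0 0, 0, H₂ 0 1; 0, h, 0; H₂ 1 0, 0, H₂ 1 1] : Matrix (Fin 3) (Fin 3) K) M ∧ mapGL (endoGL (γ₂, u)) M = M}.Finite)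
    {b : ℕ} (hb1 : 1 ≤ b) :
    ∑ᶠ B : Submodule 𝒪[K] (Fin 3 → K),
        {M : Submodule 𝒪[K] (Fin 3 → K) |
          (IsSelfDualLattice σ ϖ (!![H₂ 0 0, 0, H₂ 0 1; 0, h, 0; H₂ 1 0, 0, H₂ 1 1] : Matrix (Fin 3) (Fin 3) K) M ∧ mapGL (endoGL (γ₂, u)) M = M) ∧
            (∀ c : K, (Pi.single 1 c : Fin 3 → K) ∈ M ↔ Valued.v c ≤ Valued.v ϖ ^ b) ∧
            M ⊓ LinearMap.ker ((LinearMap.proj (1 : Fin 3) : (Fin 3 → K) →ₗ[K] K).restrictScalars 𝒪[K]) = B}.ncard =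
      ∑ᶠ B₂ ∈ {B : Submodule 𝒪[K] (Fin 2 → K) | (∃ g : GL (Fin 2) K, B = latt (g : Matrix (Fin 2) (Fin 2) K)) ∧ mapGL γ₂ B = B ∧
          ∃ w₀ : Fin 2 → K, (∀ w, w ∈ B ↔ (w ∈ dualLatt σ H₂ B ∧ Valued.v (pairing σ H₂ w₀ w) ≤ 1)) ∧
            (∀ w ∈ dualLatt σ H₂ B, ∃ (t : K) (a : Fin 2 → K), Valued.v t ≤ 1 ∧ a ∈ B ∧ w = t • w₀ + a) ∧
            Valued.v (pairing σ H₂ w₀ w₀) * Valued.v ϖ ^ (2 * b) = 1 ∧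
            (γ₂ : Matrix (Fin 2) (Fin 2) K).mulVec w₀ - (u : Matrix (Fin 1) (Fin 1) K) 0 0 • w₀ ∈ B},
        {M : Submodule 𝒪[K] (Fin 3 → K) | IsSelfDualLattice σ ϖ (!![H₂ 0 0, 0, H₂ 0 1; 0, h, 0; H₂ 1 0, 0, H₂ 1 1] : Matrix (Fin 3) (Fin 3) K) M ∧
            M ⊓ LinearMap.ker ((LinearMap.proj (1 : Fin 3) : (Fin 3 → K) →ₗ[K] K).restrictScalars 𝒪[K]) =
              B₂.map ((Matrix.toLin' (!![1, 0; 0, 0; 0, 1] : Matrix (Fin 3) (Fin 2) K)).restrictScalars 𝒪[K]) ∧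
            ∀ c : K, (Pi.single 1 c : Fin 3 → K) ∈ M ↔ Valued.v c ≤ Valued.v ϖ ^ b}.ncard := by
  classical
  set H : Matrix (Fin 3) (Fin 3) K := !![H₂ 0 0, 0, H₂ 0 1; 0, h, 0; H₂ 1 0, 0, H₂ 1 1] with hHdef
  set Wk : Submodule 𝒪[K] (Fin 3 → K) := LinearMap.ker ((LinearMap.proj (1 : Fin 3) : (Fin 3 → K) →ₗ[K] K).restrictScalars 𝒪[K]) with hWk
  set ι := ((Matrix.toLin' (!![1, 0; 0, 0; 0, 1] : Matrix (Fin 3) (Fin 2) K)).restrictScalars 𝒪[K]) with hι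
  set S : Set (Submodule 𝒪[K] (Fin 2 → K)) := {B : Submodule 𝒪[K] (Fin 2 → K) | (∃ g : GL (Fin 2) K, B = latt (g : Matrix (Fin 2) (Fin 2) K)) ∧ mapGL γ₂ B = B ∧
          ∃ w₀ : Fin 2 → K, (∀ w, w ∈ B ↔ (w ∈ dualLatt σ H₂ B ∧ Valued.v (pairing σ H₂ w₀ w) ≤ 1)) ∧
            (∀ w ∈ dualLatt σ H₂ B, ∃ (t : K) (a : Fin 2 → K), Valued.v t ≤ 1 ∧ a ∈ B ∧ w = t • w₀ + a) ∧
            Valued.v (pairing σ H₂ w₀ w₀) * Valued.v ϖ ^ (2 * b) = 1 ∧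
            (γ₂ : Matrix (Fin 2) (Fin 2) K).mulVec w₀ - (u : Matrix (Fin 1) (Fin 1) K) 0 0 • w₀ ∈ B} with hSdef
  -- the tube layer `b` of the fixed family
  set L : Set (Submodule 𝒪[K] (Fin 3 → K)) := {M | (IsSelfDualLattice σ ϖ H M ∧ mapGL (endoGL (γ₂, u)) M = M) ∧
      ∀ c : K, (Pi.single 1 c : Fin 3 → K) ∈ M ↔ Valued.v c ≤ Valued.v ϖ ^ b} with hL
  have hLfin : L.Finite := hfin.subset fun M hM => hM.1
  -- the left-hand side regroups `L` by the `W`-part: it is `#L` (★ §0 of the glue fibration)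
  have h1 : (∑ᶠ B : Submodule 𝒪[K] (Fin 3 → K), {M : Submodule 𝒪[K] (Fin 3 → K) | (IsSelfDualLattice σ ϖ H M ∧ mapGL (endoGL (γ₂, u)) M = M) ∧
      (∀ c : K, (Pi.single 1 c : Fin 3 → K) ∈ M ↔ Valued.v c ≤ Valued.v ϖ ^ b) ∧ M ⊓ Wk = B}.ncard) = L.ncard := by
    rw [ncard_eq_finsum_ncard_fiber L hLfin fun M => M ⊓ Wk]
    refine finsum_congr fun B => ?_
    congr 1
    ext M
    simp only [hL, Set.mem_setOf_eq, and_assoc]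
  -- the right-hand side regroups `L` by the plane part `ι_W⁻¹(M ∩ W)`
  rw [h1, ncard_eq_finsum_ncard_fiber L hLfin fun M => (M ⊓ Wk).comap ι, finsum_mem_def]
  refine finsum_congr fun B₂ => ?_
  by_cases hS : B₂ ∈ S
  · -- over the index set: the whole fibre is fixed, and it is exactly the `L`-fibre over `B₂`
    rw [Set.indicator_of_mem hS]
    congr 1
    ext M
    simp only [hL, Set.mem_setOf_eq]
    constructor
    · rintro ⟨⟨⟨hSD, -⟩, htube⟩, hκ⟩
      refine ⟨hSD, ?_, htube⟩
      rw [← hκ, map_comap_planeMatrix_inf_ker]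
    · rintro ⟨hSD, hW, htube⟩
      have hκ : (M ⊓ Wk).comap ι = B₂ := by rw [hW, Submodule.comap_map_eq_of_injective planeMatrix_injective]
      have hS' := hS
      rw [← hκ] at hS'
      exact ⟨⟨⟨hSD, mapGL_eq_of_comap_planeMatrix_mem_coneIndex σ hσ hvσ hϖ hH₂ hH₂σ hh hSD hb1 htube γ₂ u hΓ hu hS'⟩, htube⟩, hκ⟩
  · -- off the index set: no fixed member has this plane part
    rw [Set.indicator_of_notMem hS]
    have hempty : {M : Submodule 𝒪[K] (Fin 3 → K) | M ∈ L ∧ (M ⊓ Wk).comap ι = B₂} = ∅ := by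
      ext M
      simp only [hL, Set.mem_setOf_eq, Set.mem_empty_iff_false, iff_false]
      rintro ⟨⟨⟨hSD, hfix⟩, htube⟩, hκ⟩
      have hmem := comap_planeMatrix_mem_coneIndex_of_mapGL_eq σ hσ hvσ hϖ hH₂ hH₂σ hh hSD hb1 htube γ₂ u hΓ hu hfix
      rw [hκ] at hmem
      exact hS hmem
    rw [hempty, Set.ncard_empty]

/-! ## §6 HEAD — the fixed self-dual lattices of a unitary block element, counted through the plane -/

/-- **O-GLUE COUNT (HEAD).**  Block form `H = !![H₂ 0 0, 0, H₂ 0 1; 0, h, 0; H₂ 1 0, 0, H₂ 1 1]` (`σ` an isometric involution, `H₂` hermitian with unit determinant, `|h| = 1`, `σh = h`,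
`𝒪` a PID), `Γ = endoGL (γ₂, u)` UNITARY for `H`; if the fixed self-dual family `F = {M ∣ M self-dual, Γ·M = M}` is finite with tube coordinates `≤ R`, then
`#F = #{B₂ ∣ B₂ self-dual for H₂, γ₂·B₂ = B₂} + Σ_{b ∈ [1, R]} Σᶠ_{B₂ ∈ S_b} #{M self-dual ∣ M ∩ W = ι_W B₂, tube b}` with `S_b` = ★ p857377's cone index set (§5).  Each summand is
★ T2b's glue fibre, `= #Sol_{2b}(r_{B₂})` at any admissible `w₀` (left to the consumer). [cite: Kottwitz1986BaseChangeUnits, §1 pp. 240–241, §3 pp. 247–249] [cite: BruhatTits1972, §10] [cite: Jacobowitz1962, §4] [cite: Rogawski1990, §4.9 p. 55] -/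
theorem ncard_fixed_selfDual_endoGL_eq_axis_add_sum [IsPrincipalIdealRing 𝒪[K]] (σ : K →+* K) (hσ : ∀ a, σ (σ a) = a)
    (hvσ : ∀ a, Valued.v (σ a) = Valued.v a) {ϖ : K} (hϖ : Valued.v ϖ = WithZero.exp (-1 : ℤ))
    {H₂ : Matrix (Fin 2) (Fin 2) K} (hH₂ : IsUnit H₂.det) (hH₂σ : (H₂.map σ)ᵀ = H₂) {h : K} (hh : Valued.v h = 1)
    (γ₂ : GL (Fin 2) K) (u : GL (Fin 1) K) (hΓ : endoGL (γ₂, u) ∈ unitaryGroupOfForm σ (!![H₂ 0 0, 0, H₂ 0 1; 0, h, 0; H₂ 1 0, 0, H₂ 1 1] : Matrix (Fin 3) (Fin 3) K))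
    (hu : Valued.v ((u : Matrix (Fin 1) (Fin 1) K) 0 0) = 1) {R : ℕ}
    (hfin : {M : Submodule 𝒪[K] (Fin 3 → K) |
      IsSelfDualLattice σ ϖ (!![H₂ 0 0, 0, H₂ 0 1; 0, h, 0; H₂ 1 0, 0, H₂ 1 1] : Matrix (Fin 3) (Fin 3) K) M ∧ mapGL (endoGL (γ₂, u)) M = M}.Finite)
    (hR : ∀ M : Submodule 𝒪[K] (Fin 3 → K), IsSelfDualLattice σ ϖ (!![H₂ 0 0, 0, H₂ 0 1; 0, h, 0; H₂ 1 0, 0, H₂ 1 1] : Matrix (Fin 3) (Fin 3) K) M →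
      mapGL (endoGL (γ₂, u)) M = M → ∀ b : ℕ, (∀ c : K, (Pi.single 1 c : Fin 3 → K) ∈ M ↔ Valued.v c ≤ Valued.v ϖ ^ b) → b ≤ R) :
    {M : Submodule 𝒪[K] (Fin 3 → K) |
        IsSelfDualLattice σ ϖ (!![H₂ 0 0, 0, H₂ 0 1; 0, h, 0; H₂ 1 0, 0, H₂ 1 1] : Matrix (Fin 3) (Fin 3) K) M ∧ mapGL (endoGL (γ₂, u)) M = M}.ncard =
      {B₂ : Submodule 𝒪[K] (Fin 2 → K) | IsSelfDualLattice σ ϖ H₂ B₂ ∧ mapGL γ₂ B₂ = B₂}.ncard +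
        ∑ b ∈ Finset.Icc 1 R, ∑ᶠ B₂ ∈ {B : Submodule 𝒪[K] (Fin 2 → K) | (∃ g : GL (Fin 2) K, B = latt (g : Matrix (Fin 2) (Fin 2) K)) ∧ mapGL γ₂ B = B ∧
            ∃ w₀ : Fin 2 → K, (∀ w, w ∈ B ↔ (w ∈ dualLatt σ H₂ B ∧ Valued.v (pairing σ H₂ w₀ w) ≤ 1)) ∧
              (∀ w ∈ dualLatt σ H₂ B, ∃ (t : K) (a : Fin 2 → K), Valued.v t ≤ 1 ∧ a ∈ B ∧ w = t • w₀ + a) ∧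
              Valued.v (pairing σ H₂ w₀ w₀) * Valued.v ϖ ^ (2 * b) = 1 ∧
              (γ₂ : Matrix (Fin 2) (Fin 2) K).mulVec w₀ - (u : Matrix (Fin 1) (Fin 1) K) 0 0 • w₀ ∈ B},
          {M : Submodule 𝒪[K] (Fin 3 → K) | IsSelfDualLattice σ ϖ (!![H₂ 0 0, 0, H₂ 0 1; 0, h, 0; H₂ 1 0, 0, H₂ 1 1] : Matrix (Fin 3) (Fin 3) K) M ∧
              M ⊓ LinearMap.ker ((LinearMap.proj (1 : Fin 3) : (Fin 3 → K) →ₗ[K] K).restrictScalars 𝒪[K]) =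
                B₂.map ((Matrix.toLin' (!![1, 0; 0, 0; 0, 1] : Matrix (Fin 3) (Fin 2) K)).restrictScalars 𝒪[K]) ∧
              ∀ c : K, (Pi.single 1 c : Fin 3 → K) ∈ M ↔ Valued.v c ≤ Valued.v ϖ ^ b}.ncard := by
  -- ★ p857312: the partition by (tube coordinate, `W`-part); §1: the axis; §5: each tube layer
  rw [ncard_fixed_selfDual_eq_ncard_axis_add_sum_finsum_ncard_glueFibre σ hvσ hϖ hH₂ hh (endoGL (γ₂, u)) hfin hR,
    ncard_fixed_axis_eq_ncard_plane σ hvσ hϖ hH₂ hh γ₂ hu]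
  congr 1
  refine Finset.sum_congr rfl fun b hb => ?_
  exact finsum_ncard_glueCell_eq_finsum_mem_ncard_glueFibre σ hσ hvσ hϖ hH₂ hH₂σ hh γ₂ u hΓ hu hfin (Finset.mem_Icc.1 hb).1

end Summit.HodgeConjecture.HodgeConjecture.Cruxes.H413.F0P3cDyRamBlockGlueCount

end
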